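import Summits.QuantumFields.YangMills.Theorems.BalabanUVNodesPortU8TwoVolumeRowC

/-!
# PORT PT-B (U8), g4 file 1 — THE TWO-VOLUME ROW (R4ᴰ)′, TOKEN-PARAMETRIC IN THE GLOBAL OBJECTS: ★★ `sandwich_clauses_capped` and ★★ `rowR4D_capped_sandwich` — for ANY pair
# of global objects `G_K, G_{K+1}` obeying the ‴-clauses and WINDOW-CAPPED against the localized response `recordHrLocξ … (recordWindow R0 z₀)` of their own member, and any
# cut response vectors with `𝐔`-block `Matrix.of ∘ G` and `𝐉`-block the (1.8) linearised current of `G` — no `recordHr`, no `recordBgField`, no `UkSel`, no `rootGauge`, no Tok-182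

Cell `ym-nodeO-ideate` ∕ `ym-balaban-port`, porter `ymgap-nodeO-port-PTB-1` (gen 4).  JOIN-side helper for the decay road of **stmt-QuantumFields-27238** (K0ᴬ),
`--supports stmt-QuantumFields-27238 --as helper`, answering ★★★ director-ym №509 (iii′) ∕ №512 («the decaying object at the record is the LOCALIZED ∕ window response
`ξ·hOp` (`recordHrLocξ`), not the rooted-gauge Landau representative `recordHr`; the U8-type supply of the K0ᴬ decay road comes from `recordHrLocξ`-objects — never again from
a displayed hypothesis on `rootGauge ∘ UkSel` objects»).  The instance at the whole-torus localized data is g4 file 2 (`…TwoVolumeRowLocUniv`).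
[I] = [Balaban1987RG1], [15] = [Balaban1985Variational], [B6] = [Balaban1984PropagatorsII].

WHAT IS PROVED (kernel, sorry-free).
§1 ★★ `sandwich_clauses_capped` — the per-bond four (190)-clauses for `E := G_{K+1} ∘ lift − G_K` on the bonds of an off-wrap domain `X`, for ANY pair of global objects
   `G_K : bonds(T_K) → (Fin 2 → Fin 2 → ℂ)`, `G_{K+1}` that (i) obey the four ‴-clauses at rate `e^{−δ₉·tdist(·, y)}` on their member and (ii) are WINDOW-CAPPED against the
   localized response `recordHrLocξ … (recordWindow R0 z₀)` of their own member on `recordWindow R3 z₀` at rate `e^{−δ₉(R0−R3)}` (the letter of v11-G₄'s Tok-cmpU-cap with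
   `recordHrLocξ … Finset.univ` replaced by `G`): NEAR the label window the difference is `[cap]_{K+1} ∘ lift − [cap]_K` by ✓window transport
   (`recordHrLocξ_liftBondCtr`, zero defect under `NoWrapAt`), FAR from it both members are small by (i).  This is ✓`sandwich_clauses` (g3 file 14) with the Tok-182
   rewriting step DELETED and the global object made a parameter.
§2 ★★ `rowR4D_capped_sandwich` — the GLOBAL two-volume row in (4.4)-gauge currency for ANY pair of cut response vectors `g_K(y), g_{K+1}(y′)` whose `𝐔`-blocks on the
   domain bonds are `Matrix.of (G b)` and whose `𝐉`-blocks are the linearised current `ξ⁻³·(−i)·π(d*d (Matrix.of ∘ G))` (the (1.8) curl form), from §1: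
   `gauge ≤ C₄ · e^{−(δ₉∕4)·ρ∕2} · e^{−((δ₉∕4)∕2)·dist(y, X)}`, `C₄ = 2C·e^{δ₉(2Mc+2)}·2(3 + 2‖π_ℝ‖)e^{(δ₉∕2)Mc}∕α₂` — the constant of ✓`rowR4D_L_sandwich`.

HONEST FRAMING.  Helpers over DISPLAYED token-shaped hypotheses (asserted by nobody); nothing of Bałaban's analysis is asserted ∕ ported ∕ discharged here; 27931 is CLOSED ·
IMPLICATION-ONLY (unchanged by this file); K0ᴬ 27238 OPEN; NODE O 0∕1; COUNT 8∕28 · K 1∕4 UNMOVED; finite `𝕋⁴_{L^K}` at fixed ε — NOT continuum ∕ OS ∕ Clay;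
**the Yang–Mills mass gap (Clay) is NOT proved by any of this.**
-/

noncomputable section

open scoped BigOperators Matrix.Norms.L2Operator
open Complex (I)

namespace Summit.QuantumFields.YangMills.Theorems.PortU8

open Literature.MathematicalPhysics.QuantumFieldTheory.Balaban1983to89
open Literature.MathematicalPhysics.QuantumFieldTheory.Balaban1983to89.Node00
open Literature.MathematicalPhysics.QuantumFieldTheory.Balaban1983to89.T4Continuum (T4Family)
open Literature.MathematicalPhysics.QuantumFieldTheory.Balaban1983to89.B14.Eq213MaximalDomains (side)
open Summit.QuantumFields.YangMills.Theorems.K0RecordFormatNames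

variable (F : T4Family)

section Capped

variable {F}
variable (a₀ ε₂₉ : ℝ) {Mc k K : ℕ}

/-! ## §1  ★★ The per-bond four clauses for `E = G_{K+1} ∘ lift − G_K`, token-parametric in the global objects -/
set_option maxHeartbeats 400000 in
/-- ★★ **THE CAPPED SANDWICH, PER BOND, FOR ANY PAIR OF GLOBAL OBJECTS** `G` (member `K`, label `y = recordE K μ z`) and `G′` (member `K+1`, label `y′ = recordE (K+1) μ z`):
if each obeys the four ‴-clauses on its member (`h3`, `h3′`) and each is window-capped against its member's localized response `recordHrLocξ … (recordWindow R0 z₀)` on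
`recordWindow R3 z₀` (`hcmp`, `hcmp′` — the letter of Tok-cmpU-cap with the global object a PARAMETER), then on every bond `β` of an off-wrap domain `X` the four clause
expressions of `E := G′ ∘ lift − G` are `≤ Ĉ·η^j·e^{−(δ₉∕8)·tdist(coarse β₋, y₂)}`, `Ĉ = 2C·e^{δ₉(2Mc+2)}·e^{−(δ₉∕8)ρ}` — NEAR: caps on both members + ✓window transport;
FAR: ‴ on both members.  No Tok-182, no selector. [cite: Balaban1987RG1, (1.21) p.264, p.290 L17–20, (4.35) p.290; Balaban1985Variational, (190) p.308; Balaban1984PropagatorsII, (2.5)–(2.6) p.224] -/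
theorem sandwich_clauses_capped (hMc : McGuard F Mc) (hK : recordK₀ F Mc k ≤ K) (a : (thetaFill F a₀ ε₂₉).ιβ) (μ : Fin 4) (z : Fin 4 → ℤ)
    (hz : ∀ l, 2 * |z l| < (recordRNat F Mc k K : ℤ)) {X : (recordDomSys F Mc k K).Dom} (hX : X ∉ recordWrapCtr F Mc k K)
    {C δ₉ : ℝ} (hC : 0 ≤ C) (hδ : 0 < δ₉)
    (G : PBond (F.P K) 0 → Fin 2 → Fin 2 → ℂ) (G' : PBond (F.P (K + 1)) 0 → Fin 2 → Fin 2 → ℂ)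
    (h3 : letI Hr := G;
      ∀ b : PBond (F.P K) 0,
        ‖Hr b‖ ≤ C * (F.P K).eta (k + 1) * Real.exp (-(δ₉ * (Site.tdist (coarsenTo (k + 1) b.src) (recordE F k K μ z).2 : ℝ))) ∧
        (∀ ν : Fin (F.P K).d, ‖Hr ⟨b.src.shift ν, b.dir⟩ - Hr b‖ ≤ C * (F.P K).eta (k + 1) ^ 2 * Real.exp (-(δ₉ * (Site.tdist (coarsenTo (k + 1) b.src) (recordE F k K μ z).2 : ℝ)))) ∧
        ‖∑ ν : Fin (F.P K).d, (Hr ⟨b.src.shift ν, b.dir⟩ - (2 : ℂ) • Hr b + Hr ⟨b.src.unshift ν, b.dir⟩)‖ ≤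
          C * (F.P K).eta (k + 1) ^ 3 * Real.exp (-(δ₉ * (Site.tdist (coarsenTo (k + 1) b.src) (recordE F k K μ z).2 : ℝ))) ∧
        ‖∑ ν : Fin (F.P K).d, ((Hr ⟨b.src, b.dir⟩ + Hr ⟨(b.src).shift b.dir, ν⟩ - Hr ⟨(b.src).shift ν, b.dir⟩ - Hr ⟨b.src, ν⟩) -
          (Hr ⟨b.src.unshift ν, b.dir⟩ + Hr ⟨(b.src.unshift ν).shift b.dir, ν⟩ - Hr ⟨(b.src.unshift ν).shift ν, b.dir⟩ - Hr ⟨b.src.unshift ν, ν⟩))‖ ≤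
          C * (F.P K).eta (k + 1) ^ 3 * Real.exp (-(δ₉ * (Site.tdist (coarsenTo (k + 1) b.src) (recordE F k K μ z).2 : ℝ))))
    (h3' : letI Hr := G';
      ∀ b : PBond (F.P (K + 1)) 0,
        ‖Hr b‖ ≤ C * (F.P (K + 1)).eta (k + 1) * Real.exp (-(δ₉ * (Site.tdist (coarsenTo (k + 1) b.src) (recordE F k (K + 1) μ z).2 : ℝ))) ∧
        (∀ ν : Fin (F.P (K + 1)).d, ‖Hr ⟨b.src.shift ν, b.dir⟩ - Hr b‖ ≤ C * (F.P (K + 1)).eta (k + 1) ^ 2 * Real.exp (-(δ₉ * (Site.tdist (coarsenTo (k + 1) b.src) (recordE F k (K + 1) μ z).2 : ℝ)))) ∧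
        ‖∑ ν : Fin (F.P (K + 1)).d, (Hr ⟨b.src.shift ν, b.dir⟩ - (2 : ℂ) • Hr b + Hr ⟨b.src.unshift ν, b.dir⟩)‖ ≤
          C * (F.P (K + 1)).eta (k + 1) ^ 3 * Real.exp (-(δ₉ * (Site.tdist (coarsenTo (k + 1) b.src) (recordE F k (K + 1) μ z).2 : ℝ))) ∧
        ‖∑ ν : Fin (F.P (K + 1)).d, ((Hr ⟨b.src, b.dir⟩ + Hr ⟨(b.src).shift b.dir, ν⟩ - Hr ⟨(b.src).shift ν, b.dir⟩ - Hr ⟨b.src, ν⟩) -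
          (Hr ⟨b.src.unshift ν, b.dir⟩ + Hr ⟨(b.src.unshift ν).shift b.dir, ν⟩ - Hr ⟨(b.src.unshift ν).shift ν, b.dir⟩ - Hr ⟨b.src.unshift ν, ν⟩))‖ ≤
          C * (F.P (K + 1)).eta (k + 1) ^ 3 * Real.exp (-(δ₉ * (Site.tdist (coarsenTo (k + 1) b.src) (recordE F k (K + 1) μ z).2 : ℝ))))
    (hcmp : ∀ R3 R0 : ℕ, R3 + nestRadius Mc 1 ≤ R0 → 2 * (R0 + 1) < (F.P K).sitesPerDir (k + 1) → ∀ z₀ : Fin 4 → ℤ, (recordE F k K μ z).2 ∈ recordWindow F k K R3 z₀ →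
      letI Hd : PBond (F.P K) 0 → Fin 2 → Fin 2 → ℂ := fun b' => G b' -
        recordHrLocξ F (thetaFill F a₀ ε₂₉) k K (recordWindow F k K R0 z₀) a (recordE F k K μ z) b';
      ∀ b : PBond (F.P K) 0, coarsenTo (k + 1) b.src ∈ recordWindow F k K R3 z₀ →
        ‖Hd b‖ ≤ C * (F.P K).eta (k + 1) * Real.exp (-(δ₉ * ((R0 : ℝ) - (R3 : ℝ)))) ∧
        (∀ ν : Fin (F.P K).d, ‖Hd ⟨b.src.shift ν, b.dir⟩ - Hd b‖ ≤ C * (F.P K).eta (k + 1) ^ 2 * Real.exp (-(δ₉ * ((R0 : ℝ) - (R3 : ℝ))))) ∧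
        ‖∑ ν : Fin (F.P K).d, (Hd ⟨b.src.shift ν, b.dir⟩ - (2 : ℂ) • Hd b + Hd ⟨b.src.unshift ν, b.dir⟩)‖ ≤ C * (F.P K).eta (k + 1) ^ 3 * Real.exp (-(δ₉ * ((R0 : ℝ) - (R3 : ℝ)))) ∧
        ‖∑ ν : Fin (F.P K).d, ((Hd ⟨b.src, b.dir⟩ + Hd ⟨(b.src).shift b.dir, ν⟩ - Hd ⟨(b.src).shift ν, b.dir⟩ - Hd ⟨b.src, ν⟩) -
          (Hd ⟨b.src.unshift ν, b.dir⟩ + Hd ⟨(b.src.unshift ν).shift b.dir, ν⟩ - Hd ⟨(b.src.unshift ν).shift ν, b.dir⟩ - Hd ⟨b.src.unshift ν, ν⟩))‖ ≤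
          C * (F.P K).eta (k + 1) ^ 3 * Real.exp (-(δ₉ * ((R0 : ℝ) - (R3 : ℝ)))))
    (hcmp' : ∀ R3 R0 : ℕ, R3 + nestRadius Mc 1 ≤ R0 → 2 * (R0 + 1) < (F.P (K + 1)).sitesPerDir (k + 1) → ∀ z₀ : Fin 4 → ℤ, (recordE F k (K + 1) μ z).2 ∈ recordWindow F k (K + 1) R3 z₀ →
      letI Hd : PBond (F.P (K + 1)) 0 → Fin 2 → Fin 2 → ℂ := fun b' => G' b' -
        recordHrLocξ F (thetaFill F a₀ ε₂₉) k (K + 1) (recordWindow F k (K + 1) R0 z₀) a (recordE F k (K + 1) μ z) b';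
      ∀ b : PBond (F.P (K + 1)) 0, coarsenTo (k + 1) b.src ∈ recordWindow F k (K + 1) R3 z₀ →
        ‖Hd b‖ ≤ C * (F.P (K + 1)).eta (k + 1) * Real.exp (-(δ₉ * ((R0 : ℝ) - (R3 : ℝ)))) ∧
        (∀ ν : Fin (F.P (K + 1)).d, ‖Hd ⟨b.src.shift ν, b.dir⟩ - Hd b‖ ≤ C * (F.P (K + 1)).eta (k + 1) ^ 2 * Real.exp (-(δ₉ * ((R0 : ℝ) - (R3 : ℝ))))) ∧
        ‖∑ ν : Fin (F.P (K + 1)).d, (Hd ⟨b.src.shift ν, b.dir⟩ - (2 : ℂ) • Hd b + Hd ⟨b.src.unshift ν, b.dir⟩)‖ ≤ C * (F.P (K + 1)).eta (k + 1) ^ 3 * Real.exp (-(δ₉ * ((R0 : ℝ) - (R3 : ℝ)))) ∧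
        ‖∑ ν : Fin (F.P (K + 1)).d, ((Hd ⟨b.src, b.dir⟩ + Hd ⟨(b.src).shift b.dir, ν⟩ - Hd ⟨(b.src).shift ν, b.dir⟩ - Hd ⟨b.src, ν⟩) -
          (Hd ⟨b.src.unshift ν, b.dir⟩ + Hd ⟨(b.src.unshift ν).shift b.dir, ν⟩ - Hd ⟨(b.src.unshift ν).shift ν, b.dir⟩ - Hd ⟨b.src.unshift ν, ν⟩))‖ ≤
          C * (F.P (K + 1)).eta (k + 1) ^ 3 * Real.exp (-(δ₉ * ((R0 : ℝ) - (R3 : ℝ)))))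
    {β : PBond (F.P K) 0} (hβ : β ∈ domBonds F Mc k K X) :
    letI E : PBond (F.P K) 0 → Fin 2 → Fin 2 → ℂ := fun b' => G' (liftBondCtr F K 0 b') - G b'
    letI Ch : ℝ := 2 * C * Real.exp (δ₉ * (2 * Mc + 2)) * Real.exp (-(δ₉ / 8) * recordRNat F Mc k K)
    letI e : ℝ := Real.exp (-(δ₉ / 8 * (Site.tdist (coarsenTo (k + 1) β.src) (recordE F k K μ z).2 : ℝ)))
    ‖E ⟨β.src, β.dir⟩‖ ≤ Ch * (F.P K).eta (k + 1) * e ∧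
    (∀ ν : Fin (F.P K).d, ‖E ⟨β.src.shift ν, β.dir⟩ - E ⟨β.src, β.dir⟩‖ ≤ Ch * (F.P K).eta (k + 1) ^ 2 * e) ∧
    ‖∑ ν : Fin (F.P K).d, (E ⟨β.src.shift ν, β.dir⟩ - (2 : ℂ) • E ⟨β.src, β.dir⟩ + E ⟨β.src.unshift ν, β.dir⟩)‖ ≤ Ch * (F.P K).eta (k + 1) ^ 3 * e ∧
    ‖∑ ν : Fin (F.P K).d, ((E ⟨β.src, β.dir⟩ + E ⟨β.src.shift β.dir, ν⟩ - E ⟨β.src.shift ν, β.dir⟩ - E ⟨β.src, ν⟩) -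
      (E ⟨β.src.unshift ν, β.dir⟩ + E ⟨(β.src.unshift ν).shift β.dir, ν⟩ - E ⟨(β.src.unshift ν).shift ν, β.dir⟩ - E ⟨β.src.unshift ν, ν⟩))‖ ≤ Ch * (F.P K).eta (k + 1) ^ 3 * e := by
  have hk : k + 1 ≤ F.m + K := by unfold recordK₀ at hK; omega
  obtain ⟨hsh, hun, hus⟩ := stencil_commute_of_mem_domBonds hMc hK hX hβ
  obtain ⟨hR30, hcap, hcap', hdiff, hR3lo, h4R3⟩ := sandwich_radii hMc hK
  have hnw : NoWrapAt F k K (recordRNat F Mc k K / 2 - 1) (-z) := noWrapAt_sandwich hMc hK hz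
  have hl1 : ((recordE F k (K + 1) μ z).1 : Fin 4) = (recordE F k K μ z).1 := Fin.ext rfl
  have hl2 : (recordE F k (K + 1) μ z).2 = liftSiteCtr F K (k + 1) (recordE F k K μ z).2 := recordE_succ_snd_eq_lift F hMc hK μ z hz
  have hy2 : (recordE F k K μ z).2 = siteOfInt F K (k + 1) (-z) := rfl
  have heta : (F.P (K + 1)).eta (k + 1) = (F.P K).eta (k + 1) := rfl
  have hη0 : 0 < (F.P K).eta (k + 1) := by unfold Params.eta; exact pow_pos (inv_pos.2 (F.P K).cast_L_pos) _
  have hη2 := pow_pos hη0 2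
  have hη3 := pow_pos hη0 3
  have hMc0 : (0 : ℝ) ≤ Mc := Nat.cast_nonneg _
  have hρ0 : (0 : ℝ) ≤ (recordRNat F Mc k K : ℝ) := Nat.cast_nonneg _
  -- coarse site of the lifted bond = lift of the coarse site; torus distances do not decrease
  have hcoarse : coarsenTo (k + 1) (liftBondCtr F K 0 β).src = liftSiteCtr F K (k + 1) (coarsenTo (k + 1) β.src) :=
    coarsenTo_liftSiteCtr_of_mem_domSites hMc hK hX hβ.1
  have htt : (Site.tdist (coarsenTo (k + 1) β.src) (recordE F k K μ z).2 : ℝ) ≤ (Site.tdist (coarsenTo (k + 1) (liftBondCtr F K 0 β).src) (recordE F k (K + 1) μ z).2 : ℝ) := by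
    rw [hcoarse, hl2]; exact_mod_cast tdist_le_tdist_liftSiteCtr F K (k + 1) hk _ _
  by_cases hnear : coarsenTo (k + 1) β.src ∈ recordWindow F k K (recordRNat F Mc k K / 4 - 2 * Mc) (-z)
  · -- NEAR: `E = Hd′ ∘ lift − Hd` by window transport (no Tok-182), clauses from the caps on both members
    have htr : ∀ b' : PBond (F.P K) 0, recordHrLocξ F (thetaFill F a₀ ε₂₉) k (K + 1) (recordWindow F k (K + 1) (recordRNat F Mc k K / 2 - 1) (-z)) a (recordE F k (K + 1) μ z) (liftBondCtr F K 0 b') =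
        recordHrLocξ F (thetaFill F a₀ ε₂₉) k K (recordWindow F k K (recordRNat F Mc k K / 2 - 1) (-z)) a (recordE F k K μ z) b' := fun b' => by
      funext i i'; exact recordHrLocξ_liftBondCtr F (thetaFill F a₀ ε₂₉) hk hnw a (recordE F k K μ z) (recordE F k (K + 1) μ z) hl1 hl2 b'.src b'.dir i i'
    have hE : ∀ b' : PBond (F.P K) 0, G' (liftBondCtr F K 0 b') - G b' =
        (G' (liftBondCtr F K 0 b') -
            recordHrLocξ F (thetaFill F a₀ ε₂₉) k (K + 1) (recordWindow F k (K + 1) (recordRNat F Mc k K / 2 - 1) (-z)) a (recordE F k (K + 1) μ z) (liftBondCtr F K 0 b')) -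
          (G b' - recordHrLocξ F (thetaFill F a₀ ε₂₉) k K (recordWindow F k K (recordRNat F Mc k K / 2 - 1) (-z)) a (recordE F k K μ z) b') := by
      intro b'; rw [htr]; abel
    have hyw : (recordE F k K μ z).2 ∈ recordWindow F k K (recordRNat F Mc k K / 4 - 2 * Mc) (-z) := recordE_snd_mem_recordWindow F k K (recordRNat F Mc k K / 4 - 2 * Mc) μ z
    have hyw' : (recordE F k (K + 1) μ z).2 ∈ recordWindow F k (K + 1) (recordRNat F Mc k K / 4 - 2 * Mc) (-z) := recordE_snd_mem_recordWindow F k (K + 1) (recordRNat F Mc k K / 4 - 2 * Mc) μ z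
    have hcR3 : ∀ i, 2 * (|(-z) i| + ((recordRNat F Mc k K / 4 - 2 * Mc) : ℕ)) < ((F.P K).sitesPerDir (k + 1) : ℤ) := fun i => by
      have := NoWrapAt.two_mul_lt F hnw (Nat.le_succ (recordRNat F Mc k K / 2 - 1)) i
      linarith
    have hnear' : coarsenTo (k + 1) (liftBondCtr F K 0 β).src ∈ recordWindow F k (K + 1) (recordRNat F Mc k K / 4 - 2 * Mc) (-z) := by
      rw [hcoarse, liftSiteCtr_mem_recordWindow_iff F k K (recordRNat F Mc k K / 4 - 2 * Mc) hk (-z) hcR3]; exact hnear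
    have hA := hcmp' (recordRNat F Mc k K / 4 - 2 * Mc) (recordRNat F Mc k K / 2 - 1) hR30 hcap' (-z) hyw' (liftBondCtr F K 0 β) hnear'
    have hB := hcmp (recordRNat F Mc k K / 4 - 2 * Mc) (recordRNat F Mc k K / 2 - 1) hR30 hcap (-z) hyw β hnear
    rw [heta] at hA
    have key := clauses_sub_lift F
      (fun b' => G' b' - recordHrLocξ F (thetaFill F a₀ ε₂₉) k (K + 1) (recordWindow F k (K + 1) (recordRNat F Mc k K / 2 - 1) (-z)) a (recordE F k (K + 1) μ z) b')
      (fun b' => G b' - recordHrLocξ F (thetaFill F a₀ ε₂₉) k K (recordWindow F k K (recordRNat F Mc k K / 2 - 1) (-z)) a (recordE F k K μ z) b')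
      β.src β.dir hsh hun hus hA.1 hA.2.1 hA.2.2.1 hA.2.2.2 hB.1 hB.2.1 hB.2.2.1 hB.2.2.2
    simp only [hE]
    -- the exponential bookkeeping: `t ≤ 4R3 ≤ ρ`, `R0 − R3 ≥ ρ/4 − 2`
    have ht4 : (Site.tdist (coarsenTo (k + 1) β.src) (recordE F k K μ z).2 : ℝ) ≤ (recordRNat F Mc k K : ℝ) := by
      have h1 := tdist_le_of_mem_window F (z₀ := -z) hnear
      rw [← hy2] at h1
      have h1c : (Site.tdist (coarsenTo (k + 1) β.src) (recordE F k K μ z).2 : ℝ) ≤ ((4 * (recordRNat F Mc k K / 4 - 2 * Mc) : ℕ) : ℝ) := by exact_mod_cast h1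
      have h2 : ((4 * (recordRNat F Mc k K / 4 - 2 * Mc) : ℕ) : ℝ) ≤ (recordRNat F Mc k K : ℝ) := by exact_mod_cast h4R3
      linarith
    have hexp := exp_near_le (δ := δ₉) hδ.le hMc0 ht4 hdiff
    have hexp' : C * Real.exp (-(δ₉ * ((((recordRNat F Mc k K / 2 - 1) : ℕ) : ℝ) - (((recordRNat F Mc k K / 4 - 2 * Mc) : ℕ) : ℝ)))) + C * Real.exp (-(δ₉ * ((((recordRNat F Mc k K / 2 - 1) : ℕ) : ℝ) - (((recordRNat F Mc k K / 4 - 2 * Mc) : ℕ) : ℝ)))) ≤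
        2 * C * Real.exp (δ₉ * (2 * Mc + 2)) * Real.exp (-(δ₉ / 8) * (recordRNat F Mc k K : ℝ)) * Real.exp (-(δ₉ / 8 * (Site.tdist (coarsenTo (k + 1) β.src) (recordE F k K μ z).2 : ℝ))) := by
      have := mul_le_mul_of_nonneg_left hexp hC
      linarith
    obtain ⟨k1, k2, k3, k4⟩ := key
    refine ⟨k1.trans ?_, fun ν => (k2 ν).trans ?_, k3.trans ?_, k4.trans ?_⟩
    · have := mul_le_mul_of_nonneg_left hexp' hη0.le; linarith
    · have := mul_le_mul_of_nonneg_left hexp' hη2.le; linarith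
    · have := mul_le_mul_of_nonneg_left hexp' hη3.le; linarith
    · have := mul_le_mul_of_nonneg_left hexp' hη3.le; linarith
  · -- FAR: ‴ on both members; the lifted bond is at least as far from the lifted label
    have hA := h3' (liftBondCtr F K 0 β)
    have hB := h3 β
    rw [heta] at hA
    have htR : (recordRNat F Mc k K : ℝ) / 4 - 2 * Mc - 1 ≤ (Site.tdist (coarsenTo (k + 1) β.src) (recordE F k K μ z).2 : ℝ) := by
      have h1 := succ_le_tdist_of_not_mem_window F (z₀ := -z) hnear
      rw [← hy2] at h1
      have h1c : ((((recordRNat F Mc k K / 4 - 2 * Mc) + 1 : ℕ)) : ℝ) ≤ (Site.tdist (coarsenTo (k + 1) β.src) (recordE F k K μ z).2 : ℝ) := by exact_mod_cast h1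
      push_cast at h1c
      linarith
    have hexpB := exp_far_le (δ := δ₉) hδ.le hMc0 hρ0 htR
    have hexpA : Real.exp (-(δ₉ * (Site.tdist (coarsenTo (k + 1) (liftBondCtr F K 0 β).src) (recordE F k (K + 1) μ z).2 : ℝ))) ≤
        Real.exp (δ₉ * (2 * Mc + 2)) * Real.exp (-(δ₉ / 8) * (recordRNat F Mc k K : ℝ)) * Real.exp (-(δ₉ / 8 * (Site.tdist (coarsenTo (k + 1) β.src) (recordE F k K μ z).2 : ℝ))) := by
      refine le_trans (Real.exp_le_exp.2 ?_) hexpB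
      have := mul_le_mul_of_nonneg_left htt hδ.le
      linarith
    have key := clauses_sub_lift F G' G β.src β.dir hsh hun hus hA.1 hA.2.1 hA.2.2.1 hA.2.2.2 hB.1 hB.2.1 hB.2.2.1 hB.2.2.2
    have hsum : C * Real.exp (-(δ₉ * (Site.tdist (coarsenTo (k + 1) (liftBondCtr F K 0 β).src) (recordE F k (K + 1) μ z).2 : ℝ))) + C * Real.exp (-(δ₉ * (Site.tdist (coarsenTo (k + 1) β.src) (recordE F k K μ z).2 : ℝ))) ≤
        2 * C * Real.exp (δ₉ * (2 * Mc + 2)) * Real.exp (-(δ₉ / 8) * (recordRNat F Mc k K : ℝ)) * Real.exp (-(δ₉ / 8 * (Site.tdist (coarsenTo (k + 1) β.src) (recordE F k K μ z).2 : ℝ))) := by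
      have h1 := mul_le_mul_of_nonneg_left hexpA hC
      have h2 := mul_le_mul_of_nonneg_left hexpB hC
      linarith
    obtain ⟨k1, k2, k3, k4⟩ := key
    refine ⟨k1.trans ?_, fun ν => (k2 ν).trans ?_, k3.trans ?_, k4.trans ?_⟩
    · have := mul_le_mul_of_nonneg_left hsum hη0.le; linarith
    · have := mul_le_mul_of_nonneg_left hsum hη2.le; linarith
    · have := mul_le_mul_of_nonneg_left hsum hη3.le; linarith
    · have := mul_le_mul_of_nonneg_left hsum hη3.le; linarith

/-! ## §2  ★★ The GLOBAL two-volume row for any pair of cut response vectors with the standard blocks -/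

/-- ★★ **THE TWO-VOLUME ROW (R4ᴰ)′, TOKEN-PARAMETRIC** (one member `K`, one off-wrap domain `X`, one N-slot label): for cut response vectors `g` (member `K`, label `y`) and `g′`
(member `K+1`, label `y′`) whose `𝐔`-blocks on the domain bonds are `Matrix.of (G b)`, `Matrix.of (G′ b′)` (`hU`, `hU′`) and whose `𝐉`-blocks are the linearised currents
`ξ⁻³·(−i)·π(d*d (Matrix.of ∘ G))` (`hJ`, `hJ′`, the (1.8) curl form), the ‴-clauses and the window caps on `G, G′` (§1) give
`gauge (recordDom44J X α₂) (cutTo X (g′ ∘ recordJXJ − g)) ≤ C₄ · e^{−(δ₉∕4)·ρ∕2} · e^{−((δ₉∕4)∕2)·dist(y, X)}`, `C₄ = 2C·e^{δ₉(2Mc+2)}·2(3 + 2‖π_ℝ‖)e^{(δ₉∕2)Mc}∕α₂` (`C > 0`).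
[cite: Balaban1987RG1, (1.21) p.264, (4.4)–(4.5) pp.281–282, p.290 L17–20, (4.35) p.290, (1.8) p.261; Balaban1985Variational, (190) p.308, Prop. 9 p.309] -/
theorem rowR4D_capped_sandwich (hMc : McGuard F Mc) (hK : recordK₀ F Mc k ≤ K) (a : (thetaFill F a₀ ε₂₉).ιβ) (μ : Fin 4) (z : Fin 4 → ℤ)
    (hz : ∀ l, 2 * |z l| < (recordRNat F Mc k K : ℤ)) {X : (recordDomSys F Mc k K).Dom} (hX : X ∉ recordWrapCtr F Mc k K)
    {C δ₉ : ℝ} (hC : 0 < C) (hδ : 0 < δ₉)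
    (G : PBond (F.P K) 0 → Fin 2 → Fin 2 → ℂ) (G' : PBond (F.P (K + 1)) 0 → Fin 2 → Fin 2 → ℂ)
    (g : Fin (recordChartDimJ F K) → ℂ) (g' : Fin (recordChartDimJ F (K + 1)) → ℂ)
    (hU : ∀ b ∈ domBonds F Mc k K X, chartMatU F K (B12FormatPlus.cutTo (recordCXJ F Mc k K X) g) b = Matrix.of (fun i i' => G b i i'))
    (hU' : ∀ b' ∈ domBonds F Mc k (K + 1) (recordDomEmbCtr F Mc k K X),
      chartMatU F (K + 1) (B12FormatPlus.cutTo (recordCXJ F Mc k (K + 1) (recordDomEmbCtr F Mc k K X)) g') b' = Matrix.of (fun i i' => G' b' i i'))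
    (hJ : ∀ b ∈ domBonds F Mc k K X, letI H : PBond (F.P K) 0 → MatA 2 := fun b' => Matrix.of fun i i' => G b' i i';
      chartMatJc F K (B12FormatPlus.cutTo (recordCXJ F Mc k K X) g) b =
        ((((F.P K).eta (k + 1) : ℂ)⁻¹) ^ 3) • ((-I) • sl2Proj (∑ ν : Fin (F.P K).d,
          ((H ⟨b.src, b.dir⟩ + H ⟨b.src.shift b.dir, ν⟩ - H ⟨b.src.shift ν, b.dir⟩ - H ⟨b.src, ν⟩) -
            (H ⟨b.src.unshift ν, b.dir⟩ + H ⟨(b.src.unshift ν).shift b.dir, ν⟩ - H ⟨(b.src.unshift ν).shift ν, b.dir⟩ - H ⟨b.src.unshift ν, ν⟩)))))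
    (hJ' : ∀ b' ∈ domBonds F Mc k (K + 1) (recordDomEmbCtr F Mc k K X), letI H : PBond (F.P (K + 1)) 0 → MatA 2 := fun b'' => Matrix.of fun i i' => G' b'' i i';
      chartMatJc F (K + 1) (B12FormatPlus.cutTo (recordCXJ F Mc k (K + 1) (recordDomEmbCtr F Mc k K X)) g') b' =
        ((((F.P (K + 1)).eta (k + 1) : ℂ)⁻¹) ^ 3) • ((-I) • sl2Proj (∑ ν : Fin (F.P (K + 1)).d,
          ((H ⟨b'.src, b'.dir⟩ + H ⟨b'.src.shift b'.dir, ν⟩ - H ⟨b'.src.shift ν, b'.dir⟩ - H ⟨b'.src, ν⟩) -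
            (H ⟨b'.src.unshift ν, b'.dir⟩ + H ⟨(b'.src.unshift ν).shift b'.dir, ν⟩ - H ⟨(b'.src.unshift ν).shift ν, b'.dir⟩ - H ⟨b'.src.unshift ν, ν⟩)))))
    (h3 : letI Hr := G;
      ∀ b : PBond (F.P K) 0,
        ‖Hr b‖ ≤ C * (F.P K).eta (k + 1) * Real.exp (-(δ₉ * (Site.tdist (coarsenTo (k + 1) b.src) (recordE F k K μ z).2 : ℝ))) ∧
        (∀ ν : Fin (F.P K).d, ‖Hr ⟨b.src.shift ν, b.dir⟩ - Hr b‖ ≤ C * (F.P K).eta (k + 1) ^ 2 * Real.exp (-(δ₉ * (Site.tdist (coarsenTo (k + 1) b.src) (recordE F k K μ z).2 : ℝ)))) ∧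
        ‖∑ ν : Fin (F.P K).d, (Hr ⟨b.src.shift ν, b.dir⟩ - (2 : ℂ) • Hr b + Hr ⟨b.src.unshift ν, b.dir⟩)‖ ≤
          C * (F.P K).eta (k + 1) ^ 3 * Real.exp (-(δ₉ * (Site.tdist (coarsenTo (k + 1) b.src) (recordE F k K μ z).2 : ℝ))) ∧
        ‖∑ ν : Fin (F.P K).d, ((Hr ⟨b.src, b.dir⟩ + Hr ⟨(b.src).shift b.dir, ν⟩ - Hr ⟨(b.src).shift ν, b.dir⟩ - Hr ⟨b.src, ν⟩) -
          (Hr ⟨b.src.unshift ν, b.dir⟩ + Hr ⟨(b.src.unshift ν).shift b.dir, ν⟩ - Hr ⟨(b.src.unshift ν).shift ν, b.dir⟩ - Hr ⟨b.src.unshift ν, ν⟩))‖ ≤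
          C * (F.P K).eta (k + 1) ^ 3 * Real.exp (-(δ₉ * (Site.tdist (coarsenTo (k + 1) b.src) (recordE F k K μ z).2 : ℝ))))
    (h3' : letI Hr := G';
      ∀ b : PBond (F.P (K + 1)) 0,
        ‖Hr b‖ ≤ C * (F.P (K + 1)).eta (k + 1) * Real.exp (-(δ₉ * (Site.tdist (coarsenTo (k + 1) b.src) (recordE F k (K + 1) μ z).2 : ℝ))) ∧
        (∀ ν : Fin (F.P (K + 1)).d, ‖Hr ⟨b.src.shift ν, b.dir⟩ - Hr b‖ ≤ C * (F.P (K + 1)).eta (k + 1) ^ 2 * Real.exp (-(δ₉ * (Site.tdist (coarsenTo (k + 1) b.src) (recordE F k (K + 1) μ z).2 : ℝ)))) ∧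
        ‖∑ ν : Fin (F.P (K + 1)).d, (Hr ⟨b.src.shift ν, b.dir⟩ - (2 : ℂ) • Hr b + Hr ⟨b.src.unshift ν, b.dir⟩)‖ ≤
          C * (F.P (K + 1)).eta (k + 1) ^ 3 * Real.exp (-(δ₉ * (Site.tdist (coarsenTo (k + 1) b.src) (recordE F k (K + 1) μ z).2 : ℝ))) ∧
        ‖∑ ν : Fin (F.P (K + 1)).d, ((Hr ⟨b.src, b.dir⟩ + Hr ⟨(b.src).shift b.dir, ν⟩ - Hr ⟨(b.src).shift ν, b.dir⟩ - Hr ⟨b.src, ν⟩) -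
          (Hr ⟨b.src.unshift ν, b.dir⟩ + Hr ⟨(b.src.unshift ν).shift b.dir, ν⟩ - Hr ⟨(b.src.unshift ν).shift ν, b.dir⟩ - Hr ⟨b.src.unshift ν, ν⟩))‖ ≤
          C * (F.P (K + 1)).eta (k + 1) ^ 3 * Real.exp (-(δ₉ * (Site.tdist (coarsenTo (k + 1) b.src) (recordE F k (K + 1) μ z).2 : ℝ))))
    (hcmp : ∀ R3 R0 : ℕ, R3 + nestRadius Mc 1 ≤ R0 → 2 * (R0 + 1) < (F.P K).sitesPerDir (k + 1) → ∀ z₀ : Fin 4 → ℤ, (recordE F k K μ z).2 ∈ recordWindow F k K R3 z₀ →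
      letI Hd : PBond (F.P K) 0 → Fin 2 → Fin 2 → ℂ := fun b' => G b' -
        recordHrLocξ F (thetaFill F a₀ ε₂₉) k K (recordWindow F k K R0 z₀) a (recordE F k K μ z) b';
      ∀ b : PBond (F.P K) 0, coarsenTo (k + 1) b.src ∈ recordWindow F k K R3 z₀ →
        ‖Hd b‖ ≤ C * (F.P K).eta (k + 1) * Real.exp (-(δ₉ * ((R0 : ℝ) - (R3 : ℝ)))) ∧
        (∀ ν : Fin (F.P K).d, ‖Hd ⟨b.src.shift ν, b.dir⟩ - Hd b‖ ≤ C * (F.P K).eta (k + 1) ^ 2 * Real.exp (-(δ₉ * ((R0 : ℝ) - (R3 : ℝ))))) ∧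
        ‖∑ ν : Fin (F.P K).d, (Hd ⟨b.src.shift ν, b.dir⟩ - (2 : ℂ) • Hd b + Hd ⟨b.src.unshift ν, b.dir⟩)‖ ≤ C * (F.P K).eta (k + 1) ^ 3 * Real.exp (-(δ₉ * ((R0 : ℝ) - (R3 : ℝ)))) ∧
        ‖∑ ν : Fin (F.P K).d, ((Hd ⟨b.src, b.dir⟩ + Hd ⟨(b.src).shift b.dir, ν⟩ - Hd ⟨(b.src).shift ν, b.dir⟩ - Hd ⟨b.src, ν⟩) -
          (Hd ⟨b.src.unshift ν, b.dir⟩ + Hd ⟨(b.src.unshift ν).shift b.dir, ν⟩ - Hd ⟨(b.src.unshift ν).shift ν, b.dir⟩ - Hd ⟨b.src.unshift ν, ν⟩))‖ ≤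
          C * (F.P K).eta (k + 1) ^ 3 * Real.exp (-(δ₉ * ((R0 : ℝ) - (R3 : ℝ)))))
    (hcmp' : ∀ R3 R0 : ℕ, R3 + nestRadius Mc 1 ≤ R0 → 2 * (R0 + 1) < (F.P (K + 1)).sitesPerDir (k + 1) → ∀ z₀ : Fin 4 → ℤ, (recordE F k (K + 1) μ z).2 ∈ recordWindow F k (K + 1) R3 z₀ →
      letI Hd : PBond (F.P (K + 1)) 0 → Fin 2 → Fin 2 → ℂ := fun b' => G' b' -
        recordHrLocξ F (thetaFill F a₀ ε₂₉) k (K + 1) (recordWindow F k (K + 1) R0 z₀) a (recordE F k (K + 1) μ z) b';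
      ∀ b : PBond (F.P (K + 1)) 0, coarsenTo (k + 1) b.src ∈ recordWindow F k (K + 1) R3 z₀ →
        ‖Hd b‖ ≤ C * (F.P (K + 1)).eta (k + 1) * Real.exp (-(δ₉ * ((R0 : ℝ) - (R3 : ℝ)))) ∧
        (∀ ν : Fin (F.P (K + 1)).d, ‖Hd ⟨b.src.shift ν, b.dir⟩ - Hd b‖ ≤ C * (F.P (K + 1)).eta (k + 1) ^ 2 * Real.exp (-(δ₉ * ((R0 : ℝ) - (R3 : ℝ))))) ∧
        ‖∑ ν : Fin (F.P (K + 1)).d, (Hd ⟨b.src.shift ν, b.dir⟩ - (2 : ℂ) • Hd b + Hd ⟨b.src.unshift ν, b.dir⟩)‖ ≤ C * (F.P (K + 1)).eta (k + 1) ^ 3 * Real.exp (-(δ₉ * ((R0 : ℝ) - (R3 : ℝ)))) ∧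
        ‖∑ ν : Fin (F.P (K + 1)).d, ((Hd ⟨b.src, b.dir⟩ + Hd ⟨(b.src).shift b.dir, ν⟩ - Hd ⟨(b.src).shift ν, b.dir⟩ - Hd ⟨b.src, ν⟩) -
          (Hd ⟨b.src.unshift ν, b.dir⟩ + Hd ⟨(b.src.unshift ν).shift b.dir, ν⟩ - Hd ⟨(b.src.unshift ν).shift ν, b.dir⟩ - Hd ⟨b.src.unshift ν, ν⟩))‖ ≤
          C * (F.P (K + 1)).eta (k + 1) ^ 3 * Real.exp (-(δ₉ * ((R0 : ℝ) - (R3 : ℝ)))))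
    {α₂ : ℝ} (hα : 0 < α₂) :
    gauge (recordDom44J F Mc k K X α₂) (B12FormatPlus.cutTo (recordCXJ F Mc k K X) fun i => g' (recordJXJ F K i) - g i) ≤
      (2 * C * Real.exp (δ₉ * (2 * Mc + 2)) * (2 * (2 * 1 + 2 * ‖LinearMap.toContinuousLinearMap (sl2Proj.restrictScalars ℝ)‖ + 1) * Real.exp (4 * (δ₉ / 8) * Mc) / α₂)) *
        Real.exp (-(δ₉ / 4) * (recordRNat F Mc k K : ℝ) / 2) * Real.exp (-((δ₉ / 4) / 2) * (recordSiteGeom F Mc k K).distD (recordE F k K μ z) X) := by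
  classical
  have hη0 : 0 < (F.P K).eta (k + 1) := by unfold Params.eta; exact pow_pos (inv_pos.2 (F.P K).cast_L_pos) _
  have heta : (F.P (K + 1)).eta (k + 1) = (F.P K).eta (k + 1) := rfl
  set Ch : ℝ := 2 * C * Real.exp (δ₉ * (2 * Mc + 2)) * Real.exp (-(δ₉ / 8) * recordRNat F Mc k K) with hCh
  have hCh0 : 0 < Ch := by rw [hCh]; positivity
  -- the per-bond clauses for `E`
  have hcl := fun (β : PBond (F.P K) 0) (hβ : β ∈ domBonds F Mc k K X) =>
    sandwich_clauses_capped (F := F) a₀ ε₂₉ hMc hK a μ z hz hX hC.le hδ G G' h3 h3' hcmp hcmp' hβ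
  -- the difference vector, its `𝐔`-block and `𝐉`-block
  have hcut : B12FormatPlus.cutTo (recordCXJ F Mc k K X) (fun i => g' (recordJXJ F K i) - g i) =
      (fun i => B12FormatPlus.cutTo (recordCXJ F Mc k (K + 1) (recordDomEmbCtr F Mc k K X)) g' (recordJXJ F K i)) - B12FormatPlus.cutTo (recordCXJ F Mc k K X) g := by
    rw [show (fun i => g' (recordJXJ F K i) - g i) = (fun i => g' (recordJXJ F K i)) - g from rfl, cutTo_sub, cutTo_comp_recordJXJ hMc hK hX]
  have hUE : ∀ b ∈ domBonds F Mc k K X, chartMatU F K (B12FormatPlus.cutTo (recordCXJ F Mc k K X) fun i => g' (recordJXJ F K i) - g i) b =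
      Matrix.of ((fun b' : PBond (F.P K) 0 => G' (liftBondCtr F K 0 b') - G b') b) := by
    intro b hb
    have hb' : liftBondCtr F K 0 b ∈ domBonds F Mc k (K + 1) (recordDomEmbCtr F Mc k K X) := (liftBondCtr_mem_domBonds_iff hMc hK X hX b).2 hb
    rw [hcut, chartMatU_sub, chartMatU_comp_recordJXJ, hU' _ hb', hU _ hb]
    ext i i'; simp
  -- the `𝐉`-block: `ξ⁻³·(−i)·π(d*d E)`
  have hJE : ∀ b ∈ domBonds F Mc k K X, ‖chartMatJc F K (B12FormatPlus.cutTo (recordCXJ F Mc k K X) fun i => g' (recordJXJ F K i) - g i) b‖ ≤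
      Ch * (2 * ‖LinearMap.toContinuousLinearMap (sl2Proj.restrictScalars ℝ)‖) * Real.exp (-((δ₉ / 8) * (Site.tdist (coarsenTo (k + 1) b.src) (recordE F k K μ z).2 : ℝ))) := by
    intro b hb
    have hb' : liftBondCtr F K 0 b ∈ domBonds F Mc k (K + 1) (recordDomEmbCtr F Mc k K X) := (liftBondCtr_mem_domBonds_iff hMc hK X hX b).2 hb
    obtain ⟨hsh, hun, hus⟩ := stencil_commute_of_mem_domBonds hMc hK hX hb
    rw [hcut, chartMatJc_sub, chartMatJc_comp_recordJXJ, hJ' _ hb', hJ _ hb, heta, ← smul_sub, ← smul_sub, ← map_sub]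
    refine (norm_current_lin_le sl2Proj hη0 _).trans ?_
    have h4 := (hcl b hb).2.2.2
    have h2 := (norm_of_le_two_mul_norm _).trans (mul_le_mul_of_nonneg_left h4 zero_le_two)
    have hπ0 : 0 ≤ (((F.P K).eta (k + 1))⁻¹) ^ 3 * ‖LinearMap.toContinuousLinearMap (sl2Proj.restrictScalars ℝ)‖ := by positivity
    refine le_trans (le_of_eq ?_) ((mul_le_mul_of_nonneg_left h2 hπ0).trans (le_of_eq ?_))
    · -- the matrix identity: (K+1)-stencil at the lifted bond − K-stencil = `Matrix.of` of the stencil of `E`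
      congr 2
      change (∑ ν : Fin (F.P K).d, _) - _ = _
      rw [← Finset.sum_sub_distrib]
      ext i i'
      simp only [Matrix.sum_apply, Matrix.sub_apply, Matrix.add_apply, Matrix.of_apply, Finset.sum_apply, Pi.sub_apply, Pi.add_apply, liftBondCtr,
        hsh, hun, hus]
      exact Finset.sum_congr rfl fun ν _ => by ring
    · have hη3 : ((F.P K).eta (k + 1))⁻¹ ^ 3 * (F.P K).eta (k + 1) ^ 3 = 1 := by field_simp
      linear_combination (2 * ‖LinearMap.toContinuousLinearMap (sl2Proj.restrictScalars ℝ)‖ * Ch *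
        Real.exp (-(δ₉ / 8 * (Site.tdist (coarsenTo (k + 1) b.src) (recordE F k K μ z).2 : ℝ)))) * hη3
  -- the homogeneous generic row
  have hrow := gauge_recordDom44J_cutTo_le_of_entryDecayOn_homog (F := F) hMc hK X (recordE F k K μ z)
    (fun i => g' (recordJXJ F K i) - g i) (fun b' : PBond (F.P K) 0 => G' (liftBondCtr F K 0 b') - G b')
    hα hCh0 (P := 2 * ‖LinearMap.toContinuousLinearMap (sl2Proj.restrictScalars ℝ)‖) (δ₉ := δ₉ / 8) (by positivity) (by positivity) hUE
    (fun b hb => ⟨(hcl b hb).1, fun ν => (hcl b hb).2.1 ν, (hcl b hb).2.2.1⟩) hJE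
  refine hrow.trans (le_of_eq ?_)
  have hsplit : Real.exp (-(δ₉ / 8) * (recordRNat F Mc k K : ℝ)) = Real.exp (-(δ₉ / 4) * (recordRNat F Mc k K : ℝ) / 2) := by congr 1; ring
  have hsplit' : Real.exp (-(δ₉ / 8) * (recordSiteGeom F Mc k K).distD (recordE F k K μ z) X) =
      Real.exp (-((δ₉ / 4) / 2) * (recordSiteGeom F Mc k K).distD (recordE F k K μ z) X) := by congr 1; ring
  rw [← hsplit, ← hsplit', hCh]
  ring

end Capped

end Summit.QuantumFields.YangMills.Theorems.PortU8

end
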